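import Mathlib
import HarnessLib
import Literature.NumberTheory.Sieve.MoebiusShiftedPrimesMinorArcForm
import Summits.Parity.GeneralizedHardyLittlewood.Theorems.LiouvilleShiftedTablesEngineToPairsTIIOfX1Part1

/-!
# `stub_TII_of_X1`, part 2: Hölder over the dilations against X1 (line `Sketch`, crux `EngineToPairs`)

Second file of the Type-II leaf.  Summing the per-modulus bound of part 1 over the coprime moduli
`q ∈ moduliH h Q`, `Q ≤ x^{δ₁/2}`, Hölder's inequality with exponents `(4/3, 4)` gives
`∑_q F_q^{1/4} = ∑_q q^{−3/4} (q³ F_q)^{1/4} ≤ (∑_q 1/q)^{3/4} (∑_q q³ F_q)^{1/4}`; the last sum is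
the left side of the crux `DilatedTableChowla` at the shift `c = −h` and the choice functions
`u*, v*` (the maximising blocks), so X1 bounds it by `x²/(log x)^C`.  RESULT (`typeII_rect_family`):
for every `K > 0`, uniformly for `A` in the X1 window, `1 ≤ Q ≤ x^{δ₁/2}`, sub-boxes
`Ra ⊆ (⌊A⌋, ⌊2A⌋]`, `Cb ⊆ [1, x/A]` and ALL real coefficients,
`∑_{q ∈ moduliH h Q} |∑_{a ∈ Ra} ∑_{b ∈ Cb} α_a β_b shiftWeight h q (ab)| ≤ ‖α‖ ‖β‖ (1 + log x) x^{1/2} (log x)^{−K}`.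
-/

noncomputable section

namespace Summit.Parity.GeneralizedHardyLittlewood.Theorems.EngineToPairs

namespace TIIOfX1

open Finset Real
open Summit.Parity.GeneralizedHardyLittlewood.Theorems.DilatedTableChowla.Negative
open Summit.Parity.GeneralizedHardyLittlewood.Theses.LiouvilleShiftedTables

/-! ### Harmonic sums and Hölder -/

/-- `∑_{q ∈ moduliH h Q} 1/q ≤ 1 + log Q` for `Q ≥ 1`. [folklore] -/
theorem sum_moduliH_inv_le {h : ℕ} {Q : ℝ} (hQ : 1 ≤ Q) :
    ∑ q ∈ moduliH h Q, (q : ℝ)⁻¹ ≤ 1 + Real.log Q := by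
  have hsub : moduliH h Q ⊆ Icc 1 ⌊Q⌋₊ := Finset.filter_subset _ _
  have h1 : (1 : ℕ) ≤ ⌊Q⌋₊ := Nat.le_floor (by simpa using hQ)
  have hpos : (0 : ℝ) < (⌊Q⌋₊ : ℝ) := by exact_mod_cast h1
  calc ∑ q ∈ moduliH h Q, (q : ℝ)⁻¹ ≤ ∑ q ∈ Icc 1 ⌊Q⌋₊, (q : ℝ)⁻¹ :=
        sum_le_sum_of_subset_of_nonneg hsub fun q _ _ => by positivity
    _ ≤ 1 + Real.log (⌊Q⌋₊ : ℕ) :=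
        Literature.NumberTheory.Sieve.Lichtman2020.sum_Icc_inv_le_one_add_log _
    _ ≤ 1 + Real.log Q := by
        gcongr
        exact Nat.floor_le (by linarith)

/-- **Hölder with exponents `(4/3, 4)`**: for `G ≥ 0` on moduli `q ≥ 1`,
`∑_q G_q^{1/4} ≤ (∑_q 1/q)^{3/4} (∑_q q³ G_q)^{1/4}`. [folklore] -/
theorem sum_rpow_quarter_le (Qs : Finset ℕ) (hQ : ∀ q ∈ Qs, 1 ≤ q) (G : ℕ → ℝ)
    (hG : ∀ q, 0 ≤ G q) :
    ∑ q ∈ Qs, G q ^ (1 / 4 : ℝ) ≤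
      (∑ q ∈ Qs, (q : ℝ)⁻¹) ^ (3 / 4 : ℝ) * (∑ q ∈ Qs, (q : ℝ) ^ 3 * G q) ^ (1 / 4 : ℝ) := by
  have hpq : Real.HolderConjugate (4 / 3) 4 :=
    Real.holderConjugate_iff.2 ⟨by norm_num, by norm_num⟩
  have key := Real.inner_le_Lp_mul_Lq_of_nonneg Qs hpq
    (f := fun q : ℕ => ((q : ℝ)⁻¹) ^ (3 / 4 : ℝ))
    (g := fun q : ℕ => ((q : ℝ) ^ 3 * G q) ^ (1 / 4 : ℝ))
    (fun q _ => by positivity) (fun q _ => by have := hG q; positivity)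
  have hid : ∀ q ∈ Qs, ((q : ℝ)⁻¹) ^ (3 / 4 : ℝ) * ((q : ℝ) ^ 3 * G q) ^ (1 / 4 : ℝ) =
      G q ^ (1 / 4 : ℝ) := by
    intro q hq
    have hq0 : (0 : ℝ) < q := Nat.cast_pos.2 (hQ q hq)
    have h3 : ((q : ℝ) ^ 3) ^ (1 / 4 : ℝ) = (q : ℝ) ^ (3 / 4 : ℝ) := by
      rw [← Real.rpow_natCast, ← Real.rpow_mul hq0.le]
      norm_num
    rw [Real.mul_rpow (by positivity) (hG q), h3, Real.inv_rpow hq0.le, ← mul_assoc,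
      inv_mul_cancel₀ (Real.rpow_pos_of_pos hq0 _).ne', one_mul]
  have hf : ∀ q ∈ Qs, (((q : ℝ)⁻¹) ^ (3 / 4 : ℝ)) ^ (4 / 3 : ℝ) = (q : ℝ)⁻¹ := by
    intro q _
    have hq0 : (0 : ℝ) ≤ (q : ℝ)⁻¹ := by positivity
    rw [← Real.rpow_mul hq0]
    norm_num
  have hg : ∀ q ∈ Qs, (((q : ℝ) ^ 3 * G q) ^ (1 / 4 : ℝ)) ^ (4 : ℝ) = (q : ℝ) ^ 3 * G q := by
    intro q _
    have h0 : (0 : ℝ) ≤ (q : ℝ) ^ 3 * G q := by have := hG q; positivity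
    rw [← Real.rpow_mul h0]
    norm_num
  calc ∑ q ∈ Qs, G q ^ (1 / 4 : ℝ)
      = ∑ q ∈ Qs, ((q : ℝ)⁻¹) ^ (3 / 4 : ℝ) * ((q : ℝ) ^ 3 * G q) ^ (1 / 4 : ℝ) :=
        (sum_congr rfl hid).symm
    _ ≤ (∑ q ∈ Qs, (((q : ℝ)⁻¹) ^ (3 / 4 : ℝ)) ^ (4 / 3 : ℝ)) ^ (1 / (4 / 3) : ℝ) *
          (∑ q ∈ Qs, (((q : ℝ) ^ 3 * G q) ^ (1 / 4 : ℝ)) ^ (4 : ℝ)) ^ (1 / 4 : ℝ) := key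
    _ = _ := by
        rw [sum_congr rfl hf, sum_congr rfl hg, show (1 / (4 / 3) : ℝ) = 3 / 4 by norm_num]

/-! ### The rectangular family bound -/

/-- **X1 in.** For `h ≥ 1`, `0 < δ₁ ≤ 1/12`, `C > 0` and `x ≥ x₀`: uniformly for `A` in the X1 window,
`1 ≤ Q ≤ x^{δ₁/2}` and all real coefficients,
`∑_{q ∈ moduliH h Q} |∑∑ α_a β_b shiftWeight h q (ab)| ≤ ‖α‖ ‖β‖ (1 + log Q)^{3/4} (x²/(log x)^C)^{1/4}`.
[this line] -/
theorem sum_moduliH_abs_rect_le (hX : DilatedTableChowla) {h : ℕ} (hh : 1 ≤ h) {δ₁ : ℝ}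
    (hδ₁ : 0 < δ₁) (hδ₁' : δ₁ ≤ 1 / 12) {C : ℝ} (hC : 0 < C) :
    ∃ x₀ : ℝ, ∀ x : ℝ, x₀ ≤ x → ∀ A : ℝ, x ^ δ₁ ≤ A → A ≤ x ^ (1 / 3 + δ₁) →
      ∀ Q : ℝ, 1 ≤ Q → Q ≤ x ^ (δ₁ / 2) → ∀ α β : ℕ → ℝ,
        ∑ q ∈ moduliH h Q, |∑ a ∈ Ioc ⌊A⌋₊ ⌊2 * A⌋₊, ∑ b ∈ Icc 1 ⌊x / A⌋₊,
            α a * β b * shiftWeight h q (a * b)| ≤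
          Real.sqrt (∑ a ∈ Ioc ⌊A⌋₊ ⌊2 * A⌋₊, α a ^ 2) *
            Real.sqrt (∑ b ∈ Icc 1 ⌊x / A⌋₊, β b ^ 2) *
            ((1 + Real.log Q) ^ (3 / 4 : ℝ) * (x ^ 2 / Real.log x ^ C) ^ (1 / 4 : ℝ)) := by
  have hc : (-(h : ℤ)) ≠ 0 := by omega
  obtain ⟨x₀, hx₀⟩ := (crux_iff_lhs.1 hX) (-(h : ℤ)) hc δ₁ hδ₁ hδ₁' C hC
  refine ⟨x₀, fun x hx A hA1 hA2 Q hQ1 hQ2 α β => ?_⟩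
  set nα : ℝ := Real.sqrt (∑ a ∈ Ioc ⌊A⌋₊ ⌊2 * A⌋₊, α a ^ 2) with hnα
  set nβ : ℝ := Real.sqrt (∑ b ∈ Icc 1 ⌊x / A⌋₊, β b ^ 2) with hnβ
  have hper : ∀ q : ℕ, ∃ u v : ℕ, 1 ≤ q → Nat.Coprime q h →
      |∑ a ∈ Ioc ⌊A⌋₊ ⌊2 * A⌋₊, ∑ b ∈ Icc 1 ⌊x / A⌋₊, α a * β b * shiftWeight h q (a * b)| ≤
        nα * nβ * F (-(h : ℤ)) x A q u v ^ (1 / 4 : ℝ) := by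
    intro q
    by_cases hq : 1 ≤ q ∧ Nat.Coprime q h
    · obtain ⟨u, v, huv⟩ := abs_rect_le h hq.1 hq.2 x A α β
      exact ⟨u, v, fun _ _ => huv⟩
    · exact ⟨0, 0, fun h1 h2 => absurd ⟨h1, h2⟩ hq⟩
  choose u v huv using hper
  have key := hx₀ x hx A hA1 hA2 u v
  have hQs1 : ∀ q ∈ moduliH h Q, 1 ≤ q := fun q hq => (mem_moduliH.1 hq).1.1
  have hsub : moduliH h Q ⊆ Icc 1 ⌊x ^ (δ₁ / 2)⌋₊ := by
    intro q hq
    have hq' := mem_moduliH.1 hq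
    exact mem_Icc.2 ⟨hq'.1.1, hq'.1.2.trans (Nat.floor_le_floor hQ2)⟩
  have hF0 : ∀ q, 0 ≤ F (-(h : ℤ)) x A q (u q) (v q) := fun q => F_nonneg _ _ _ _ _ _
  calc ∑ q ∈ moduliH h Q,
        |∑ a ∈ Ioc ⌊A⌋₊ ⌊2 * A⌋₊, ∑ b ∈ Icc 1 ⌊x / A⌋₊, α a * β b * shiftWeight h q (a * b)|
      ≤ ∑ q ∈ moduliH h Q, nα * nβ * F (-(h : ℤ)) x A q (u q) (v q) ^ (1 / 4 : ℝ) :=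
        sum_le_sum fun q hq => huv q (hQs1 q hq) (mem_moduliH.1 hq).2
    _ = nα * nβ * ∑ q ∈ moduliH h Q, F (-(h : ℤ)) x A q (u q) (v q) ^ (1 / 4 : ℝ) := by
        rw [mul_sum]
    _ ≤ nα * nβ * ((∑ q ∈ moduliH h Q, (q : ℝ)⁻¹) ^ (3 / 4 : ℝ) *
          (∑ q ∈ moduliH h Q, (q : ℝ) ^ 3 * F (-(h : ℤ)) x A q (u q) (v q)) ^ (1 / 4 : ℝ)) := by
        have h0 : 0 ≤ nα * nβ := by positivity
        exact mul_le_mul_of_nonneg_left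
          (sum_rpow_quarter_le _ hQs1 (fun q => F (-(h : ℤ)) x A q (u q) (v q)) hF0) h0
    _ ≤ nα * nβ * ((1 + Real.log Q) ^ (3 / 4 : ℝ) * (x ^ 2 / Real.log x ^ C) ^ (1 / 4 : ℝ)) := by
        have h0 : 0 ≤ nα * nβ := by positivity
        refine mul_le_mul_of_nonneg_left ?_ h0
        have hH : (∑ q ∈ moduliH h Q, (q : ℝ)⁻¹) ^ (3 / 4 : ℝ) ≤ (1 + Real.log Q) ^ (3 / 4 : ℝ) :=
          Real.rpow_le_rpow (sum_nonneg fun q _ => by positivity) (sum_moduliH_inv_le hQ1)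
            (by norm_num)
        have hS0 : 0 ≤ ∑ q ∈ moduliH h Q, (q : ℝ) ^ 3 * F (-(h : ℤ)) x A q (u q) (v q) :=
          sum_nonneg fun q _ => term_nonneg _ _ _ _ _ _
        have hL : (∑ q ∈ moduliH h Q, (q : ℝ) ^ 3 * F (-(h : ℤ)) x A q (u q) (v q)) ^ (1 / 4 : ℝ) ≤
            (x ^ 2 / Real.log x ^ C) ^ (1 / 4 : ℝ) := by
          refine Real.rpow_le_rpow hS0 ?_ (by norm_num)
          calc ∑ q ∈ moduliH h Q, (q : ℝ) ^ 3 * F (-(h : ℤ)) x A q (u q) (v q)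
              ≤ lhs (-(h : ℤ)) δ₁ x A u v :=
                sum_le_sum_of_subset_of_nonneg hsub fun q _ _ => term_nonneg _ _ _ _ _ _
            _ ≤ x ^ 2 / Real.log x ^ C := key
        have hH0 : 0 ≤ (∑ q ∈ moduliH h Q, (q : ℝ)⁻¹) ^ (3 / 4 : ℝ) := by positivity
        have hQ0 : 0 ≤ (1 + Real.log Q) ^ (3 / 4 : ℝ) :=
          Real.rpow_nonneg (by have := Real.log_nonneg hQ1; linarith) _
        exact mul_le_mul hH hL (by positivity) hQ0

/-- Restricting coefficients to a sub-box: an indicator inside a product. [folklore] -/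
theorem sum_indicator_mul {s t : Finset ℕ} (hts : t ⊆ s) (f g : ℕ → ℝ) :
    ∑ a ∈ s, (if a ∈ t then f a else 0) * g a = ∑ a ∈ t, f a * g a := by
  rw [← Finset.sum_subset hts (fun a _ hat => by rw [if_neg hat, zero_mul])]
  exact Finset.sum_congr rfl fun a ha => by rw [if_pos ha]

/-- Restricting coefficients to a sub-box: the `ℓ²` norm. [folklore] -/
theorem sum_indicator_sq {s t : Finset ℕ} (hts : t ⊆ s) (f : ℕ → ℝ) :
    ∑ a ∈ s, (if a ∈ t then f a else 0) ^ 2 = ∑ a ∈ t, f a ^ 2 := by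
  rw [← Finset.sum_subset hts (fun a _ hat => by rw [if_neg hat]; ring)]
  exact Finset.sum_congr rfl fun a ha => by rw [if_pos ha]

/-- `(x² / L^{4K})^{1/4} = x^{1/2} / L^K` for `x, L ≥ 0`. [folklore] -/
theorem rpow_quarter_window {x L K : ℝ} (hx : 0 ≤ x) (hL : 0 ≤ L) :
    (x ^ 2 / L ^ (4 * K)) ^ (1 / 4 : ℝ) = x ^ (1 / 2 : ℝ) / L ^ K := by
  rw [Real.div_rpow (by positivity) (Real.rpow_nonneg hL _), ← Real.rpow_natCast x 2,
    ← Real.rpow_mul hx, ← Real.rpow_mul hL]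
  congr 1
  · norm_num
  · rw [show (4 * K * (1 / 4) : ℝ) = K by ring]

/-- **RESULT of parts 1–2 (the rectangular Type-II family bound).**  Assume `DilatedTableChowla`.
For `h ≥ 1`, `0 < δ₁ ≤ 1/12`, `K > 0` there is `x₀` such that for `x ≥ x₀`, every scale `A` with
`x^{δ₁} ≤ A ≤ x^{1/3+δ₁}`, every `1 ≤ Q ≤ x^{δ₁/2}`, all sub-boxes `Ra ⊆ (⌊A⌋, ⌊2A⌋]`, `Cb ⊆ [1, x/A]`
and ALL real coefficients `α, β`:
`∑_{q ∈ moduliH h Q} |∑_{a ∈ Ra} ∑_{b ∈ Cb} α_a β_b shiftWeight h q (ab)| ≤ ‖α‖₂ ‖β‖₂ (1 + log x) √x (log x)^{−K}`.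
[this line] -/
theorem typeII_rect_family (hX : DilatedTableChowla) {h : ℕ} (hh : 1 ≤ h) {δ₁ : ℝ}
    (hδ₁ : 0 < δ₁) (hδ₁' : δ₁ ≤ 1 / 12) {K : ℝ} (hK : 0 < K) :
    ∃ x₀ : ℝ, ∀ x : ℝ, x₀ ≤ x → ∀ A : ℝ, x ^ δ₁ ≤ A → A ≤ x ^ (1 / 3 + δ₁) →
      ∀ Q : ℝ, 1 ≤ Q → Q ≤ x ^ (δ₁ / 2) →
      ∀ Ra Cb : Finset ℕ, Ra ⊆ Ioc ⌊A⌋₊ ⌊2 * A⌋₊ → Cb ⊆ Icc 1 ⌊x / A⌋₊ → ∀ α β : ℕ → ℝ,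
        ∑ q ∈ moduliH h Q, |∑ a ∈ Ra, ∑ b ∈ Cb, α a * β b * shiftWeight h q (a * b)| ≤
          Real.sqrt (∑ a ∈ Ra, α a ^ 2) * Real.sqrt (∑ b ∈ Cb, β b ^ 2) *
            ((1 + Real.log x) * x ^ (1 / 2 : ℝ) / Real.log x ^ K) := by
  have hC : (0 : ℝ) < 4 * K := by positivity
  obtain ⟨x₀, hx₀⟩ := sum_moduliH_abs_rect_le hX hh hδ₁ hδ₁' hC
  refine ⟨max x₀ 3, fun x hx A hA1 hA2 Q hQ1 hQ2 Ra Cb hRa hCb α β => ?_⟩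
  have hx0 : x₀ ≤ x := le_trans (le_max_left _ _) hx
  have hx3 : (3 : ℝ) ≤ x := le_trans (le_max_right _ _) hx
  have hx1 : (1 : ℝ) ≤ x := by linarith
  have hL0 : 0 ≤ Real.log x := Real.log_nonneg hx1
  have key := hx₀ x hx0 A hA1 hA2 Q hQ1 hQ2 (fun a => if a ∈ Ra then α a else 0)
    (fun b => if b ∈ Cb then β b else 0)
  have hrect : ∀ q, ∑ a ∈ Ioc ⌊A⌋₊ ⌊2 * A⌋₊, ∑ b ∈ Icc 1 ⌊x / A⌋₊,
      (if a ∈ Ra then α a else 0) * (if b ∈ Cb then β b else 0) * shiftWeight h q (a * b) =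
      ∑ a ∈ Ra, ∑ b ∈ Cb, α a * β b * shiftWeight h q (a * b) := by
    intro q
    have h1 : ∀ a ∈ Ioc ⌊A⌋₊ ⌊2 * A⌋₊,
        ∑ b ∈ Icc 1 ⌊x / A⌋₊, (if a ∈ Ra then α a else 0) * (if b ∈ Cb then β b else 0) *
            shiftWeight h q (a * b) =
          (if a ∈ Ra then α a else 0) * ∑ b ∈ Cb, β b * shiftWeight h q (a * b) := by
      intro a _
      rw [← sum_indicator_mul hCb, mul_sum]
      exact sum_congr rfl fun b _ => by ring
    rw [sum_congr rfl h1, sum_indicator_mul hRa]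
    refine sum_congr rfl fun a _ => ?_
    rw [mul_sum]
    exact sum_congr rfl fun b _ => by ring
  have hnα : ∑ a ∈ Ioc ⌊A⌋₊ ⌊2 * A⌋₊, (if a ∈ Ra then α a else 0) ^ 2 = ∑ a ∈ Ra, α a ^ 2 :=
    sum_indicator_sq hRa α
  have hnβ : ∑ b ∈ Icc 1 ⌊x / A⌋₊, (if b ∈ Cb then β b else 0) ^ 2 = ∑ b ∈ Cb, β b ^ 2 :=
    sum_indicator_sq hCb β
  beta_reduce at key
  rw [hnα, hnβ] at key
  simp only [hrect] at key
  refine key.trans (mul_le_mul_of_nonneg_left ?_ (by positivity))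
  -- the window factor
  rw [rpow_quarter_window (by linarith) hL0]
  have hQx : Q ≤ x := by
    refine hQ2.trans ?_
    calc x ^ (δ₁ / 2) ≤ x ^ (1 : ℝ) := Real.rpow_le_rpow_of_exponent_le hx1 (by linarith)
      _ = x := Real.rpow_one x
  have hlogQ : Real.log Q ≤ Real.log x := Real.log_le_log (by linarith) hQx
  have hlogQ0 : 0 ≤ Real.log Q := Real.log_nonneg hQ1
  have h1 : (1 + Real.log Q) ^ (3 / 4 : ℝ) ≤ 1 + Real.log x := by
    calc (1 + Real.log Q) ^ (3 / 4 : ℝ) ≤ (1 + Real.log Q) ^ (1 : ℝ) :=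
          Real.rpow_le_rpow_of_exponent_le (by linarith) (by norm_num)
      _ = 1 + Real.log Q := Real.rpow_one _
      _ ≤ 1 + Real.log x := by linarith
  rw [mul_div_assoc]
  exact mul_le_mul_of_nonneg_right h1 (by positivity)

end TIIOfX1

/-- Anchor of part 2 of `stub_TII_of_X1`: the harmonic sum over the coprime moduli is at most
`1 + log Q`. [this line] -/
theorem tiiOfX1_part2_anchor :
    ∀ (h : ℕ) (Q : ℝ), 1 ≤ Q → ∑ q ∈ moduliH h Q, (q : ℝ)⁻¹ ≤ 1 + Real.log Q :=
  fun _ _ hQ => TIIOfX1.sum_moduliH_inv_le hQ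

end Summit.Parity.GeneralizedHardyLittlewood.Theorems.EngineToPairs

end
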